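import Summits.HodgeConjecture.HodgeConjecture.Theorems.F0P6aKillEngineKillEngine
import Literature.NumberTheory.NumberFields.GaloisConjugatePrimeIdealArithmetic
import HarnessLib

/-!
# `F0P6aKillEngine` — ★ RE-HOME of `Lines/F0_P6a_KillEngine.lean` (tree sha16 0f1eef433cafb2e3), PART 2 of 2 — tree lines :350–:614 (LAST part: the module the `Lines/` shim and consumers import; it transitively carries parts 1–1).

See PART 1 `Theorems/F0P6aKillEngineKillEngine.lean` for the full ★ re-home header and the original module docstring (verbatim there).  Same namespace (every fully-qualified name unchanged);
the scopes open at the cut (`noncomputable section` ∕ `namespace` ∕ `section`s) are re-opened below with their `variable` ∕ `open` ∕ `set_option` ∕ `omit` ∕ `include` ∕ `universe` lines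
replayed verbatim from the tree, in order; the code after the replay block is the tree bytes :350–:614, untouched.  HC_CM is proved only modulo the 7 printed citations (2 remaining: hLiu418 = stmt-HodgeConjecture-24832, h413 = stmt-HodgeConjecture-24833) until rung 0 closes; a re-home is count-neutral.
-/

-- ── replay of the scopes open at tree line :350 (verbatim) ──
set_option autoImplicit false
set_option linter.dupNamespace false
noncomputable section
namespace Summit.HodgeConjecture.HodgeConjecture.Cruxes.HLiu418.F0P6aLineSpecialisation
open CategoryTheory CategoryTheory.Limits NumberField IsDedekindDomain MulAction AlgebraicGeometry
open scoped Matrix Polynomial Pointwise MonoidalCategory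
open Literature.NumberTheory.GaloisRepresentations
open Literature.NumberTheory.Automorphic Literature.NumberTheory.Automorphic.UnitaryGroup
open Literature.AlgebraicGeometry.ShimuraVarieties.UnitaryCanonicalModel
open Literature.NumberTheory.Automorphic.Liu2021.AppendixC
open Literature.AlgebraicGeometry.Motives (AlgPoints IntegralModel SchemeOver thickening thickeningGalAction thickeningLift specOver extendPoint
  specValuationSubring specFractionFieldι specRingHomι)
open Literature.NumberTheory.DiophantineGeometry (geomResidueField specialFibreFunctor specResidueField geomClosedPointIsoSpecResidueField
  geomResidueFieldEquiv toClosureValuationSubring)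
open Literature.AlgebraicGeometry.RelativeSpec (ActionOver)
open Literature.NumberTheory.EllipticCurves (genericFibre specGenericPoint)
open Literature.AlgebraicGeometry.AbelianSchemes Literature.AlgebraicGeometry.AbelianSchemes.AbelianSchemeOver
open Literature.AlgebraicGeometry.GroupSchemes.AffineGroupScheme (Alg)
open Summit.HodgeConjecture.HodgeConjecture.Cruxes.HLiu418.F0P6aModuliDatumDefs
open Summit.HodgeConjecture.HodgeConjecture.Cruxes.HLiu418.F0P6aRGDAssembly
open Summit.HodgeConjecture.HodgeConjecture.Cruxes.HLiu418.F0P6aDatumOfInputs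
section KillEngine
set_option synthInstance.maxHeartbeats 100000
open Literature.AlgebraicGeometry.GroupSchemes (GroupSchemeKernel.ker GroupSchemeKernel.kerι GroupSchemeKernel.kerLift GroupSchemeKernel.kerLift_ι
  GroupSchemeKernel.kerι_comp GroupSchemeKernel.isClosedImmersion_kerι_left_of_isSeparated)
open Literature.AlgebraicGeometry.GroupSchemes.AffineGroupScheme (quotIncl ptEquiv spI exists_comp_quotIncl_eq_of_le_ker exists_hom_comp_eq_quotIncl_of_forall
  ptEquiv_quotIncl pullback_map_quotIncl_sat_comp_eq_one quotIncl_spI_comp_eq_one_of_pullback_map flat_specOver_quotient_sat_hom algBaseChangeEquiv)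
variable {F : Type} [Field F] [NumberField F] [IsCMField F] {ι₁ : F →+* ℂ}
    {Jstar : Matrix (Fin 2) (Fin 2) F}
    {K₀ : C5.OpenCompactSubgroup ↥(finAdelic ↥(maximalRealSubfield F) F (IsCMField.complexConj F) 2 Jstar)}
    {S : RecordSystemGS F Jstar ι₁ K₀} {hU7ₛ : S.HeckeTranslateDefinedOver}
    {hJ : (Jstar.map (IsCMField.complexConj F))ᵀ = Jstar} {hJu : IsUnit Jstar}
    {Fi : Type} [Field Fi] [Algebra F Fi] {Kc : C5.SmallLevel K₀} {G : Type} [Group G]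
    {𝓜 : IntegralModel (𝓞 F) F ((thickening F Fi).obj (S.M.obj Kc))}
    {w : HeightOneSpectrum (𝓞 F)} {hw : (IsCMField.complexConj F) • w ≠ w} {h𝓨 : (𝓜.localise w).IsSmoothProper 1}
    {θ : ActionOver (𝓜.localise w).total.hom ((Fi ≃ₐ[F] Fi) × G)}
    {e : Fi →ₐ[F] AlgebraicClosure (w.adicCompletion F)}
variable (I : RGDInputsAt F ι₁ Jstar K₀ S hU7ₛ hJ hJu Fi Kc G 𝓜 w hw h𝓨 θ e)
-- ── tree bytes :350–:614 ──

/-! ### §5 THE BANKED SINGLE-MAP ROAD, RE-PROVED AT ≤ 400 000: ★ p849812 hoisted (`𝒞`, `v` binders), the two 5e290d36 heads through §1′∕§2 -/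

/-! #### §5a two generic conjugation lemmas (any category ∕ any `Over X` of schemes) -/

section Conj

universe v' u'

/-- Conjugating an intertwiner by isomorphisms that intertwine: `α′ ≫ (e₁⁻¹ ≫ u ≫ e₂) = (e₁⁻¹ ≫ u ≫ e₂) ≫ β′`. [cite: MumfordFogartyKirwan1994, Ch. 7 §2 Definition 7.2 (p. 129)] -/
theorem conj_inv_hom_comm {C : Type u'} [Category.{v'} C] {A A' B B' : C} (e₁ : A ≅ A') (e₂ : B ≅ B') (u : A ⟶ B)
    {α : A ⟶ A} {α' : A' ⟶ A'} {β : B ⟶ B} {β' : B' ⟶ B'}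
    (hα : α ≫ e₁.hom = e₁.hom ≫ α') (hβ : β ≫ e₂.hom = e₂.hom ≫ β') (hu : α ≫ u = u ≫ β) :
    α' ≫ (e₁.inv ≫ u ≫ e₂.hom) = (e₁.inv ≫ u ≫ e₂.hom) ≫ β' := by
  have h1 : α' ≫ e₁.inv = e₁.inv ≫ α := by rw [Iso.comp_inv_eq, Category.assoc, Iso.eq_inv_comp, hα]
  rw [reassoc_of% h1, reassoc_of% hu, hβ]
  simp only [Category.assoc]

/-- Conjugating the other way: `α ≫ (e₁ ≫ u ≫ e₂⁻¹) = (e₁ ≫ u ≫ e₂⁻¹) ≫ β`. [cite: MumfordFogartyKirwan1994, Ch. 7 §2 Definition 7.2 (p. 129)] -/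
theorem conj_hom_inv_comm {C : Type u'} [Category.{v'} C] {A A' B B' : C} (e₁ : A ≅ A') (e₂ : B ≅ B') (u : A' ⟶ B')
    {α : A ⟶ A} {α' : A' ⟶ A'} {β : B ⟶ B} {β' : B' ⟶ B'}
    (hα : α ≫ e₁.hom = e₁.hom ≫ α') (hβ : β ≫ e₂.hom = e₂.hom ≫ β') (hu : α' ≫ u = u ≫ β') :
    α ≫ (e₁.hom ≫ u ≫ e₂.inv) = (e₁.hom ≫ u ≫ e₂.inv) ≫ β := by
  have h2 : β' ≫ e₂.inv = e₂.inv ≫ β := by rw [Iso.comp_inv_eq, Category.assoc, Iso.eq_inv_comp, hβ]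
  rw [reassoc_of% hα, reassoc_of% hu, h2]
  simp only [Category.assoc]

/-- Finite surjective morphisms of `X`-schemes stay finite surjective after conjugation by isomorphisms. [cite: GortzWedhorn2020, Prop. 12.11 (p. 325)] -/
theorem isFinite_surjective_left_conj_inv_hom {X : Scheme.{u'}} {A A' B B' : Over X} (e₁ : A ≅ A') (e₂ : B ≅ B') (u : A ⟶ B)
    [IsFinite u.left] [Surjective u.left] : IsFinite (e₁.inv ≫ u ≫ e₂.hom).left ∧ Surjective (e₁.inv ≫ u ≫ e₂.hom).left := by
  haveI : IsIso e₁.inv.left := by change IsIso ((Over.forget _).map _); infer_instance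
  haveI : IsIso e₂.hom.left := by change IsIso ((Over.forget _).map _); infer_instance
  rw [Over.comp_left, Over.comp_left]
  exact ⟨inferInstance, inferInstance⟩

/-- Flat surjective morphisms of `X`-schemes stay flat surjective after conjugation by isomorphisms. [cite: GortzWedhorn2020, Prop. 14.3 (p. 425)] -/
theorem flat_surjective_left_conj_hom_inv {X : Scheme.{u'}} {A A' B B' : Over X} (e₁ : A ≅ A') (e₂ : B ≅ B') (u : A' ⟶ B')
    [Flat u.left] [Surjective u.left] : Flat (e₁.hom ≫ u ≫ e₂.inv).left ∧ Surjective (e₁.hom ≫ u ≫ e₂.inv).left := by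
  haveI : IsIso e₁.hom.left := by change IsIso ((Over.forget _).map _); infer_instance
  haveI : IsIso e₂.inv.left := by change IsIso ((Over.forget _).map _); infer_instance
  rw [Over.comp_left, Over.comp_left]
  exact ⟨inferInstance, inferInstance⟩

end Conj

/-! #### §5b the upstairs return hom (5e290d36 :1617–:1708 verbatim) -/

-- (K6 ★ twin — gate `dedup.landed`, dealer LA3-plan (g5)): the tree's LOCAL copy of `exists_mem_not_mem_mul_eq_natCast` (17 l. incl. docstring)
-- is DELETED here; the landed ★ `Literature.NumberTheory.NumberFields.exists_mem_not_mem_mul_eq_natCast`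
-- (`GaloisConjugatePrimeIdealArithmetic.lean`) is cited by FQN at its use site(s) in this file.  Every other byte = tree ED. of record.

set_option maxHeartbeats 400000 in
open scoped MonObj in
set_option backward.isDefEq.respectTransparency false in
/-- **(ρ1) UPSTAIRS — THE HOM `u₀ := q ≫ d_a : A_y → A_{quotΩ y L}` OF THE ROOF OF `hroof y L`** ((T𝒜) of LA2-plan «ρ-ROAD v2»): from `RoofΩ` (r1)–(r4) at `(y, quotΩ y L)`, both legs
finite surjective (★ `roof_legs_isFinite_surjective_of_polarization`, `I.relDim`, `I.hpChar`, ★ `Polarization.nonempty_unitHatSlice_iso`), the return hom `d_a` of `c` at a scalar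
`a ∈ 𝔭_w ∖ 𝔭_{c•w}` with `a·a′ = N ≠ 0` (★ p849652 `exists_isMonHom_cover_comp_eq_of_forall_algPoints`), and `u₀ := q ≫ d_a`: a homomorphism, `ι`-EQUIVARIANT (★ p849652 from (r4)),
FINITE and SURJECTIVE (★ p849652), whose kernel contains `K ⊇ L` ((r1)) and meets the `𝔭_{c•w}`-torsion Ω̄-points exactly in `L` (★ p849652 `comp_eq_one_of_comp_comp_eq_one_of_forall_mem`,
`𝔭_w ≤ (a) + 𝔭_w𝔭_{c•w}`).  Everything in the D-line's generic-fibre currency `schΩOf`∕`actΩOf`∕`fibreΩOf`. [cite: Liu2021, Prop. D.8 (2) p. 135, p. 137] [cite: MumfordAV1970, §7 Thm. 4 (p. 72)] -/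
theorem exists_upstairs_returnHom (I : RGDInputsAt F ι₁ Jstar K₀ S hU7ₛ hJ hJu Fi Kc G 𝓜 w hw h𝓨 θ e)
    (quotΩ : ∀ y, LineOf I y → AlgPoints (S.M.obj Kc) (AlgebraicClosure (w.adicCompletion F))) (hroof : RoofLink I quotΩ)
    (y : AlgPoints (S.M.obj Kc) (AlgebraicClosure (w.adicCompletion F))) (L : LineOf I y) :
    ∃ (B : AbelianSchemeOver (Spec (.of (AlgebraicClosure (w.adicCompletion F)))))
      (q : (schΩOf S Kc 𝓜 w e I.univ y).X ⟶ B.X) (_ : IsMonHom q)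
      (d : B.X ⟶ (schΩOf S Kc 𝓜 w e I.univ (quotΩ y L)).X) (_ : IsMonHom d)
      (K : Subgroup ((fibreΩOf S Kc 𝓜 w e I.univ y).Points (AlgebraicClosure (w.adicCompletion F)))),
      (∀ P, P ∈ L.1 ↔ P ∈ K ∧ IsIdealTorsionΩ S Kc 𝓜 w e I.univ I.act y ((IsCMField.complexConj F) • w).asIdeal P) ∧
      (∀ P : (fibreΩOf S Kc 𝓜 w e I.univ y).Points (AlgebraicClosure (w.adicCompletion F)),
        (AlgPoints.map q P : B.toAffine.toAbelianVariety.Points (AlgebraicClosure (w.adicCompletion F))) = 1 ↔ P ∈ K) ∧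
      IsFinite (q ≫ d).left ∧ Surjective (q ≫ d).left ∧
      (∀ x : 𝓞 F, (actΩOf S Kc 𝓜 w e I.univ I.act x y).hom.hom.hom ≫ (q ≫ d) = (q ≫ d) ≫ (actΩOf S Kc 𝓜 w e I.univ I.act x (quotΩ y L)).hom.hom.hom) := by
  haveI : IsProper (𝓜.localise w).total.hom := h𝓨.2
  haveI : CharZero (w.adicCompletion F) := charZero_of_injective_algebraMap (algebraMap F (w.adicCompletion F)).injective
  haveI : CharZero (AlgebraicClosure (w.adicCompletion F)) :=
    charZero_of_injective_algebraMap (algebraMap (w.adicCompletion F) (AlgebraicClosure (w.adicCompletion F))).injective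
  -- (1) the roof at `(y, L)`
  obtain ⟨K, hK, hR⟩ := hroof y L
  obtain ⟨B, DB, lamB, hlamB, hDB, q, hq, c, hc, r1, r2, r2s, r3q, -, r4, -⟩ := hR
  haveI := hlamB; haveI := hq; haveI := hc
  haveI := B.isProper
  -- (2) both legs are finite and surjective
  have hDy := (polΩOf S Kc 𝓜 w e I.univ I.pol y).nonempty_unitHatSlice_iso
  have hp0 : I.pChar ≠ 0 := I.hpChar.1.ne_zero
  have hker2 : ∀ Pt : (fibreΩOf S Kc 𝓜 w e I.univ (quotΩ y L)).Points (AlgebraicClosure (w.adicCompletion F)),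
      (AlgPoints.map c Pt : B.toAffine.toAbelianVariety.Points (AlgebraicClosure (w.adicCompletion F))) = 1 →
        ∀ a ∈ w.asIdeal, (AlgPoints.map (((I.act.baseChange ((𝓜.localise w).genericIso'.inv.left ≫
            pullback.fst (𝓜.localise w).total.hom (specGenericPoint (HeightOneSpectrum.valuationSubringAtPrime F w) F))).baseChange
            (thickeningLift e (S.M.obj Kc) (quotΩ y L)).left).i a) Pt :
          (fibreΩOf S Kc 𝓜 w e I.univ (quotΩ y L)).Points (AlgebraicClosure (w.adicCompletion F))) = 1 :=
    fun Pt hPt a ha => (r2 Pt).1 hPt a ha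
  obtain ⟨hqs, hqf, hcs, hcf⟩ := roof_legs_isFinite_surjective_of_polarization
    ((𝓜.localise w).genericIso'.inv.left ≫ pullback.fst (𝓜.localise w).total.hom (specGenericPoint (HeightOneSpectrum.valuationSubringAtPrime F w) F))
    (thickeningLift e (S.M.obj Kc) y).left (thickeningLift e (S.M.obj Kc) (quotΩ y L)).left I.relDim I.act I.dual I.pol DB hDB hDy q c lamB
    hp0 r3q hp0 I.hpChar.2 hker2 r2s
  haveI := hqs; haveI := hqf; haveI := hcs; haveI := hcf
  -- (3) a scalar `a ∈ 𝔭_w ∖ 𝔭_{c•w}` with `a·a′ = N ≠ 0`, and the return hom `d` of `c` at `a`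
  obtain ⟨a, a', N, hN, haw, -, haa'⟩ := Literature.NumberTheory.NumberFields.exists_mem_not_mem_mul_eq_natCast w ((IsCMField.complexConj F) • w) hw
  have hkc : ∀ P : specOver (AlgebraicClosure (w.adicCompletion F)) (AlgebraicClosure (w.adicCompletion F)) ⟶ (schΩOf S Kc 𝓜 w e I.univ (quotΩ y L)).X,
      P ≫ c = 1 → P ≫ ((I.act.baseChange ((𝓜.localise w).genericIso'.inv.left ≫
            pullback.fst (𝓜.localise w).total.hom (specGenericPoint (HeightOneSpectrum.valuationSubringAtPrime F w) F))).baseChange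
            (thickeningLift e (S.M.obj Kc) (quotΩ y L)).left).i a = 1 :=
    fun P hP => (r2 P).1 hP a haw
  obtain ⟨d, hd, hcd⟩ := exists_isMonHom_cover_comp_eq_of_forall_algPoints
    ((I.act.baseChange ((𝓜.localise w).genericIso'.inv.left ≫
      pullback.fst (𝓜.localise w).total.hom (specGenericPoint (HeightOneSpectrum.valuationSubringAtPrime F w) F))).baseChange
      (thickeningLift e (S.M.obj Kc) (quotΩ y L)).left) c a hkc
  haveI := hd
  -- (4) `u₀ := q ≫ d`: equivariant, finite, surjective
  have hequ := i_comp_comp_eq_comp_comp_i_of_common_intertwiner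
    ((I.act.baseChange ((𝓜.localise w).genericIso'.inv.left ≫
      pullback.fst (𝓜.localise w).total.hom (specGenericPoint (HeightOneSpectrum.valuationSubringAtPrime F w) F))).baseChange
      (thickeningLift e (S.M.obj Kc) y).left)
    ((I.act.baseChange ((𝓜.localise w).genericIso'.inv.left ≫
      pullback.fst (𝓜.localise w).total.hom (specGenericPoint (HeightOneSpectrum.valuationSubringAtPrime F w) F))).baseChange
      (thickeningLift e (S.M.obj Kc) (quotΩ y L)).left) q c d a hcd hkc r4
  have hKq := finite_setOf_map_eq_one_of_pullback_polarization
    (I.dual.baseChange ((𝓜.localise w).genericIso'.inv.left ≫ pullback.fst (𝓜.localise w).total.hom (specGenericPoint (HeightOneSpectrum.valuationSubringAtPrime F w) F)))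
    (I.pol.baseChange ((𝓜.localise w).genericIso'.inv.left ≫ pullback.fst (𝓜.localise w).total.hom (specGenericPoint (HeightOneSpectrum.valuationSubringAtPrime F w) F)))
    (thickeningLift e (S.M.obj Kc) y).left DB hDB hDy q lamB hp0 r3q
  obtain ⟨hus, huf⟩ := surjective_comp_and_isFinite_comp_of_isOfRelDim
    ((I.act.baseChange ((𝓜.localise w).genericIso'.inv.left ≫
      pullback.fst (𝓜.localise w).total.hom (specGenericPoint (HeightOneSpectrum.valuationSubringAtPrime F w) F))).baseChange
      (thickeningLift e (S.M.obj Kc) (quotΩ y L)).left) q c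
    ((I.relDim.baseChange _).baseChange (thickeningLift e (S.M.obj Kc) y).left) d a a' hN haa' hcd hKq
  exact ⟨B, q, hq, d, hd, K, hK, r1, huf, hus, hequ⟩

/-! #### §5c ★ p849812 HOISTED: the target family `𝒞` and the generic homomorphism `v` are binders (the 𝒞-retarget) -/

set_option maxHeartbeats 400000 in
open scoped MonObj CategoryTheory.Obj in
set_option backward.isDefEq.respectTransparency false in
/-- **(ν8R) ON THE `R`-MODELS, IN THE LEAFLET'S TOKENS — `𝒞` AND `v` AS BINDERS.**  For ANY abelian scheme `𝒞 → 𝓨` (e.g. `I.univ`, or the Serre-twist family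
`serreTensor I.act E' hE'`), any two points `y, y″` and ANY homomorphism `v : (famOf I y)_η → (𝒞 ×_𝓨 ỹ″)_η` of the generic fibres of the `R`-models, ★ p849812
`exists_hom_modelSpecialFibre_of_hom_modelGenericFibre` at the leaflet's special base point `sκ w` (`hsb := specMap_toGeomκ_eq w`; `liftOf = extendPoint …` and
`sΩ w = (η_R).left` definitionally): a homomorphism `v̄` of the special fibres with (i) finite surjective ⇒ flat surjective, (ii) equivariance for endomorphism pairs,
(v-b) KILL along every flat `𝒦 ↪ famOf I y`.  This is the ★ p849812 application of 5e290d36 `exists_modelRedHom`, HOISTED. [cite: SerreTate1968, §1 Lemma 2 and Theorem 1]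
[cite: BoschLutkebohmertRaynaud1990, §1.2 Prop. 8 and §7.3 Prop. 6 (p. 180)] [cite: Hartshorne1977, II.4.7] -/
theorem exists_modelRedHom_of_generic (𝒞 : AbelianSchemeOver (𝓜.localise w).total.left)
    (y y'' : AlgPoints (S.M.obj Kc) (AlgebraicClosure (w.adicCompletion F)))
    (v : ((famOf I y).baseChange (sΩ w)).X ⟶ ((𝒞.baseChange (liftOf S Kc 𝓜 w h𝓨 e y'').left).baseChange (sΩ w)).X) [IsMonHom v] :
    ∃ (vbar : ((famOf I y).baseChange (sκ w)).X ⟶ ((𝒞.baseChange (liftOf S Kc 𝓜 w h𝓨 e y'').left).baseChange (sκ w)).X) (_ : IsMonHom vbar),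
      (IsFinite v.left → Surjective v.left → Flat vbar.left ∧ Surjective vbar.left) ∧
      (∀ (f : I.univ.X ⟶ I.univ.X) (g : 𝒞.X ⟶ 𝒞.X) [IsMonHom f] [IsMonHom g],
        (Over.pullback (sΩ w)).map (baseChangeHom f (liftOf S Kc 𝓜 w h𝓨 e y).left) ≫ v =
            v ≫ (Over.pullback (sΩ w)).map (baseChangeHom g (liftOf S Kc 𝓜 w h𝓨 e y'').left) →
          (Over.pullback (sκ w)).map (baseChangeHom f (liftOf S Kc 𝓜 w h𝓨 e y).left) ≫ vbar =
            vbar ≫ (Over.pullback (sκ w)).map (baseChangeHom g (liftOf S Kc 𝓜 w h𝓨 e y'').left)) ∧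
      (∀ (𝒦 : Over (Spec (.of ↥(closureValuationSubring (w.adicCompletion F))))) (incl : 𝒦 ⟶ (famOf I y).X) [Flat 𝒦.hom],
        (Over.pullback (sΩ w)).map incl ≫ v = 1 → (Over.pullback (sκ w)).map incl ≫ vbar = 1) := by
  haveI : IsProper (𝓜.localise w).total.hom := h𝓨.2
  exact exists_hom_modelSpecialFibre_of_hom_modelGenericFibre (𝓜.localise w) I.univ 𝒞 (thickeningLift e (S.M.obj Kc) y)
    (thickeningLift e (S.M.obj Kc) y'') (sκ w) (specMap_toGeomκ_eq w) v

/-! #### §5d the two 5e290d36 heads, statements VERBATIM, re-proved at ≤ 400 000 -/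

set_option maxHeartbeats 400000 in
open scoped MonObj in
set_option backward.isDefEq.respectTransparency false in
/-- **(ρ1) ON THE `R`-MODELS — `exists_modelRedHom`** (5e290d36 :1797 statement VERBATIM; was 1 600 000 heartbeats, now ≤ 400 000 through §5a∕§5c∕§1′): a homomorphism
`v̄ : (famOf I y) ×_R κ̄ → (famOf I (quotΩ y L)) ×_R κ̄` of the SPECIAL FIBRES OF THE LIFTS, flat and surjective, equivariant for the lifted actions, killing the special
fibre of the flat closure `V(J^sat) ↪ layerR I y` of the line's admissible ideal `J = eL L`.  CONSTRUCTION (T𝒜): `u₀ := q ≫ d_a` of `exists_upstairs_returnHom`,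
`v := (σ3)⁻¹ ≫ u₀ ≫ (σ3)″` (equivariant by §5a `conj_inv_hom_comm` at `actΩ_comp_isoGenericOf_hom`), reduced by §5c; the generic kill is §1′ composed with `d ≫ (σ3)″`.
[cite: Liu2021, Prop. D.8 (2) p. 135, p. 137] [cite: SerreTate1968, §1 Lemma 2] [cite: BoschLutkebohmertRaynaud1990, §7.3 Prop. 6 (p. 180)] [cite: EGAIV2, Prop. 2.8.5] -/
theorem exists_modelRedHom (I : RGDInputsAt F ι₁ Jstar K₀ S hU7ₛ hJ hJu Fi Kc G 𝓜 w hw h𝓨 θ e)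
    (quotΩ : ∀ y, LineOf I y → AlgPoints (S.M.obj Kc) (AlgebraicClosure (w.adicCompletion F))) (hroof : RoofLink I quotΩ)
    (y : AlgPoints (S.M.obj Kc) (AlgebraicClosure (w.adicCompletion F))) (L : LineOf I y) :
    haveI := isMonHom_transR I y
    haveI := isAffine_layerR_left I y
    haveI := isAffine_layerΩ_left I y
    ∃ vbar : ((famOf I y).baseChange (sκ w)).X ⟶ ((famOf I (quotΩ y L)).baseChange (sκ w)).X,
      IsMonHom vbar ∧ Flat vbar.left ∧ Surjective vbar.left ∧
      (∀ x : 𝓞 F, ((actFamOf I y).baseChange (sκ w)).i x ≫ vbar = vbar ≫ ((actFamOf I (quotΩ y L)).baseChange (sκ w)).i x) ∧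
      (Over.pullback (sκ w)).map (quotIncl (layerR I y) (((eLOf I y L).1.map (algBaseChangeEquiv (AlgebraicClosure (w.adicCompletion F)) (layerR I y))).comap
        (Algebra.TensorProduct.includeRight : Alg (layerR I y) →ₐ[↥(closureValuationSubring (w.adicCompletion F))]
          TensorProduct ↥(closureValuationSubring (w.adicCompletion F)) (AlgebraicClosure (w.adicCompletion F)) (Alg (layerR I y))))) ≫
        (Over.pullback (sκ w)).map (ιR I y) ≫ vbar = 1 := by
  haveI := isMonHom_transR I y
  haveI := isAffine_layerR_left I y
  haveI := isAffine_layerΩ_left I y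
  haveI := isMonHom_isoGenericOf_hom I y
  haveI := isMonHom_isoGenericOf_hom I (quotΩ y L)
  -- (1)–(4) upstairs: `u₀ := q ≫ d`
  obtain ⟨B, q, hq, d, hd, K, hK, r1, huf, hus, hequ⟩ := exists_upstairs_returnHom I quotΩ hroof y L
  haveI := hq; haveI := hd; haveI := huf; haveI := hus
  -- (5) `v := (σ3)⁻¹ ≫ u₀ ≫ (σ3)″`
  haveI hvmon : IsMonHom ((isoGenericOf I y).inv ≫ (q ≫ d) ≫ (isoGenericOf I (quotΩ y L)).hom) := by infer_instance
  have hfs := isFinite_surjective_left_conj_inv_hom (isoGenericOf I y) (isoGenericOf I (quotΩ y L)) (q ≫ d)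
  have hveq : ∀ x : 𝓞 F, ((actFamOf I y).baseChange (sΩ w)).i x ≫ ((isoGenericOf I y).inv ≫ (q ≫ d) ≫ (isoGenericOf I (quotΩ y L)).hom) =
      ((isoGenericOf I y).inv ≫ (q ≫ d) ≫ (isoGenericOf I (quotΩ y L)).hom) ≫ ((actFamOf I (quotΩ y L)).baseChange (sΩ w)).i x :=
    fun x => conj_inv_hom_comm (isoGenericOf I y) (isoGenericOf I (quotΩ y L)) (q ≫ d)
      (actΩ_comp_isoGenericOf_hom I y x) (actΩ_comp_isoGenericOf_hom I (quotΩ y L) x) (hequ x)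
  -- the generic kill of the closure (§1′), composed with `d ≫ (σ3)″`
  have hgen : (Over.pullback (sΩ w)).map (closureInclOf I y L) ≫ ((isoGenericOf I y).inv ≫ (q ≫ d) ≫ (isoGenericOf I (quotΩ y L)).hom) = 1 := by
    have h := congrArg (fun φ => φ ≫ d ≫ (isoGenericOf I (quotΩ y L)).hom) (pullback_map_closure_comp_eq_one I y L q K hK r1)
    simpa only [Category.assoc, MonObj.one_comp] using h
  -- (6) reduce: §5c at `𝒞 := I.univ`
  have hM := exists_modelRedHom_of_generic I I.univ y (quotΩ y L)
    ((isoGenericOf I y).inv ≫ (q ≫ d) ≫ (isoGenericOf I (quotΩ y L)).hom)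
  obtain ⟨vbar, hvbar, hi, hii, hvb⟩ := hM
  have hfs' := hi hfs.1 hfs.2
  haveI := flat_closure_hom I y L
  refine ⟨vbar, hvbar, hfs'.1, hfs'.2, fun x => ?_, ?_⟩
  · haveI := I.act.isMonHom x
    exact hii (I.act.i x) (I.act.i x) (hveq x)
  · have h := hvb _ (closureInclOf I y L) hgen
    rw [← Category.assoc, ← Functor.map_comp]
    exact h

set_option maxHeartbeats 400000 in
open scoped MonObj CategoryTheory.Obj in
set_option backward.isDefEq.respectTransparency false in
/-- **(ρ1) KILLS HALF — `exists_redHom_spGeoOf_kills`** (5e290d36 :1884 statement VERBATIM; was 1 600 000 heartbeats, now ≤ 400 000 through §5a∕§2): for every lift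
`(y, L)` a homomorphism `ψ̄ : A_{red₀ y} → A_{red₀ (quotΩ y L)}`, FLAT and SURJECTIVE, `𝒪_F`-EQUIVARIANT for the dock actions, KILLING `V(spGeoOf I 𝔡 y L) ↪ G₀ (red₀ y) ↪ A_{red₀ y}`:
`ψ̄ := (σ2) ≫ v̄ ≫ (σ2)″⁻¹` with `v̄` from `exists_modelRedHom`; equivariance by §5a `conj_hom_inv_comm` at `act₀_i_comp_isoSpecialOf_hom`; the kill is §2 after `(σ2)⁻¹ ≫ (σ2) = 𝟙`.
[cite: Liu2021, Prop. D.8 (2) p. 135, p. 137] [cite: SerreTate1968, §1 Lemma 2] [cite: EGAIV2, Prop. 2.8.5] [cite: Tate1997FiniteFlatGroupSchemes, (3.7)] -/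
theorem exists_redHom_spGeoOf_kills (I : RGDInputsAt F ι₁ Jstar K₀ S hU7ₛ hJ hJu Fi Kc G 𝓜 w hw h𝓨 θ e) [ExpChar (geomResidueField w) I.pChar]
    (𝔡 : ∀ xbar, DockAt I xbar)
    (quotΩ : ∀ y, LineOf I y → AlgPoints (S.M.obj Kc) (AlgebraicClosure (w.adicCompletion F))) (hroof : RoofLink I quotΩ)
    (y : AlgPoints (S.M.obj Kc) (AlgebraicClosure (w.adicCompletion F))) (L : LineOf I y) :
    letI := (𝔡 (red₀Of S Kc 𝓜 w h𝓨 e y)).grp₀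
    haveI := (𝔡 (red₀Of S Kc 𝓜 w h𝓨 e y)).aff₀
    ∃ ψ : (sch₀Of 𝓜 w I.univ (red₀Of S Kc 𝓜 w h𝓨 e y)).X ⟶ (sch₀Of 𝓜 w I.univ (red₀Of S Kc 𝓜 w h𝓨 e (quotΩ y L))).X,
      IsMonHom ψ ∧ Flat ψ.left ∧ Surjective ψ.left ∧
      (∀ a : 𝓞 F,
        ((I.act.baseChange (pullback.fst (𝓜.localise w).total.hom (specResidueField w))).baseChange (red₀Of S Kc 𝓜 w h𝓨 e y).left).i a ≫ ψ =
          ψ ≫ ((I.act.baseChange (pullback.fst (𝓜.localise w).total.hom (specResidueField w))).baseChange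
            (red₀Of S Kc 𝓜 w h𝓨 e (quotΩ y L)).left).i a) ∧
      quotIncl (𝔡 (red₀Of S Kc 𝓜 w h𝓨 e y)).G₀ (spGeoOf I 𝔡 y L).1 ≫ (𝔡 (red₀Of S Kc 𝓜 w h𝓨 e y)).ι₀G ≫ ψ = 1 := by
  letI := (𝔡 (red₀Of S Kc 𝓜 w h𝓨 e y)).grp₀
  haveI := (𝔡 (red₀Of S Kc 𝓜 w h𝓨 e y)).aff₀
  haveI := isMonHom_transR I y
  haveI := isAffine_layerR_left I y
  haveI := isAffine_layerΩ_left I y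
  haveI := isMonHom_isoSpecialOf_hom I y
  haveI := isMonHom_isoSpecialOf_hom I (quotΩ y L)
  have hM := exists_modelRedHom I quotΩ hroof y L
  obtain ⟨vbar, hvbar, hvbflat, hvbsurj, hii, hspec⟩ := hM
  haveI := hvbar; haveI := hvbflat; haveI := hvbsurj
  have hfs := flat_surjective_left_conj_hom_inv (isoSpecialOf I y) (isoSpecialOf I (quotΩ y L)) vbar
  refine ⟨(isoSpecialOf I y).hom ≫ vbar ≫ (isoSpecialOf I (quotΩ y L)).inv, inferInstance, hfs.1, hfs.2, fun x => ?_, ?_⟩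
  · exact conj_hom_inv_comm (isoSpecialOf I y) (isoSpecialOf I (quotΩ y L)) vbar
      (act₀_i_comp_isoSpecialOf_hom I y x) (act₀_i_comp_isoSpecialOf_hom I (quotΩ y L) x) (hii x)
  · refine quotIncl_spGeoOf_comp_eq_one_of_pullback_map I 𝔡 y L _ ?_
    rw [Iso.inv_hom_id_assoc, Functor.map_comp, Category.assoc]
    have h := congrArg (· ≫ (isoSpecialOf I (quotΩ y L)).inv) hspec
    simpa only [Category.assoc, MonObj.one_comp] using h

end KillEngine

end Summit.HodgeConjecture.HodgeConjecture.Cruxes.HLiu418.F0P6aLineSpecialisation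

end
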